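import Summits.BirchSwinnertonDyer.BirchSwinnertonDyer.Theorems.ManinLocalTwoThreeAtkinLehnerOrbitAction
import Literature.NumberTheory.EllipticCurves.ModularCurveEtaQuotientsProofs
import Literature.NumberTheory.EllipticCurves.HeckeOperatorsAdjointProofs
import HarnessLib

/-!
# Generic points for the Atkin–Lehner action: the fixed loci of `w(Q)` on `Y₀(N)` are countable and `E(ℂ)` is uncountable
(kernel step (1b) of es's THEOREM L♮ / E-es-173♭; cell bsd-f2-manin, prover p2 gen 20; `--supports stmt-BirchSwinnertonDyer-22967`)

* `eq_one_of_moebius_coeffs_zero` — the integer heart: if the cross-polynomial of `w(Q) = (Qx, y; QM, Q)` (`Qx − My = 1`) and of some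
  `γ = (a b; c d) ∈ SL₂(ℤ)` vanishes identically, then `Q = 1` (so `w(Q)`, `Q > 1`, is never a `Γ₀(N)`-element up to scalars);
* `finite_setOf_atkinLehnerW_smul_eq_smul` — for `Q ∥ N`, `Q ≠ 1`, `γ ∈ SL₂(ℤ)`: `{τ ∈ ℍ : w(Q)·τ = γ·τ}` is finite (roots of a non-zero quadratic);
* `countable_setOf_y0mk_atkinLehnerW_smul_eq` — hence the fixed locus of `w(Q)` on `Y₀(N)`, pulled back to `ℍ`, is countable (`Γ₀(N)` is countable);
* `countable_setOf_exists_y0mk_atkinLehnerW_prodOrdProj_smul_eq` — the union over all `Q_S`, `∅ ≠ S ⊆` primes of `N`;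
* `not_countable_univ_point`, `exists_point_not_mem_of_countable` — `E(ℂ)` is uncountable (`uniformize : ℂ ↠ E(ℂ)` has countable fibres
  `z₀ + Λ`), so a countable set of points (e.g. `φ`(bad locus) ∪ the `deg_spec` exceptions) misses some point.
HONEST FRAMING: point-set bookkeeping; nothing about `deg φ`, C2 or BSD is proved here. [folklore]
[cite: Knapp1993, Lemma 9.24 (shape of w(Q))] [cite: DiamondShurman2005, §2.3 (elliptic points; shape)]
-/

set_option autoImplicit false
-- lint-debt: the directory name repeats the summit name (sibling precedent `ManinLocalTwoThreeAtkinLehnerOrbitAction.lean`)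
set_option linter.dupNamespace false

noncomputable section

open scoped MatrixGroups ModularForm
open CongruenceSubgroup Matrix.SpecialLinearGroup UpperHalfPlane
open Literature.NumberTheory.EllipticCurves Literature.NumberTheory.EllipticCurves.ModularForms

namespace Summit.BirchSwinnertonDyer.BirchSwinnertonDyer.Theorems.ManinLocalTwoThree.AtkinLehnerOrbit

variable {N : ℕ} [NeZero N]

/-! ## §1 The integer heart: `w(Q)` (`Q > 1`) is not a scalar multiple of an element of `SL₂(ℤ)` -/

omit [NeZero N] in
/-- If `(Qxτ + y)(cτ + d) ≡ (aτ + b)(QMτ + Q)` identically (all three coefficients vanish) with `Qx − My = 1` and `ad − bc = 1`,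
then `Q = 1`. [folklore] -/
theorem eq_one_of_moebius_coeffs_zero {Q M : ℕ} (hQ : Q ≠ 0) (hM : M ≠ 0) {x y a b c d : ℤ}
    (hbez : (Q : ℤ) * x - M * y = 1) (hdet : a * d - b * c = 1)
    (hA : (Q : ℤ) * x * c = a * (Q * M)) (hB : (Q : ℤ) * x * d + y * c = a * Q + b * (Q * M)) (hC : y * d = b * Q) :
    Q = 1 := by
  have hQ0 : (Q : ℤ) ≠ 0 := by exact_mod_cast hQ
  have hM0 : (M : ℤ) ≠ 0 := by exact_mod_cast hM
  have hbezQ : (Q : ℤ) * Q * x - Q * M * y = Q := by linear_combination (Q : ℤ) * hbez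
  have h1 : (Q : ℤ) * x * d - Q * M * b = d :=
    mul_left_cancel₀ hQ0 (by linear_combination d * hbezQ + (Q : ℤ) * M * hC)
  have h2 : d = a * Q - y * c := by linear_combination hB - h1
  have h3 : c = M * d := mul_left_cancel₀ hQ0 (by linear_combination -(Q : ℤ) * M * h2 - c * hbezQ + Q * hA)
  have h4 : x * d = a :=
    mul_left_cancel₀ (mul_ne_zero hQ0 hM0) (by linear_combination hA - (Q : ℤ) * x * h3)
  have h6 : d * (x * d - b * M) = 1 := by linear_combination d * h4 + hdet + b * h3
  have h7 : (Q : ℤ) * (a - M * b) = d := by linear_combination d * hbez - (Q : ℤ) * h4 + M * hC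
  have hd : d = 1 ∨ d = -1 := Int.eq_one_or_neg_one_of_mul_eq_one h6
  have hdvd : (Q : ℤ) ∣ 1 := by
    rcases hd with hd | hd
    · exact ⟨a - M * b, by rw [h7, hd]⟩
    · exact ⟨-(a - M * b), by linear_combination h7 + hd⟩
  exact_mod_cast Int.eq_one_of_dvd_one (by positivity) hdvd

/-! ## §2 `{τ : w(Q)·τ = γ·τ}` is finite for `Q ≠ 1` -/

/-- **The Möbius maps of `w(Q)` (`Q ∥ N`, `Q ≠ 1`) and of any `γ ∈ SL₂(ℤ)` agree at only finitely many points of `ℍ`** (roots of a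
non-zero quadratic; the quadratic is non-zero by `eq_one_of_moebius_coeffs_zero`). [folklore] -/
theorem finite_setOf_atkinLehnerW_smul_eq_smul {Q : ℕ} [NeZero Q] (hQN : Q ∣ N) (hc : Nat.Coprime Q (N / Q)) (hQ1 : Q ≠ 1)
    (γ : SL(2, ℤ)) : {τ : ℍ | glCast (atkinLehnerW N Q : GL (Fin 2) ℚ) • τ = γ • τ}.Finite := by
  set x : ℤ := (atkinLehnerSL N Q) 0 0 with hx
  set y : ℤ := (atkinLehnerSL N Q) 0 1 with hy
  set M : ℕ := N / Q with hMdef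
  have hNQM : N = Q * M := (Nat.mul_div_cancel' hQN).symm
  have hM0 : M ≠ 0 := fun h ↦ NeZero.ne N (by rw [hNQM, h, mul_zero])
  have hbez : (Q : ℤ) * x - M * y = 1 := atkinLehnerSL_bezout N Q hc
  have hdet : γ 0 0 * γ 1 1 - γ 0 1 * γ 1 0 = 1 := det_entries γ
  -- the cross-polynomial coefficients
  set A : ℤ := (Q : ℤ) * x * γ 1 0 - γ 0 0 * N with hA
  set B : ℤ := (Q : ℤ) * x * γ 1 1 + y * γ 1 0 - γ 0 0 * Q - γ 0 1 * N with hB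
  set C : ℤ := y * γ 1 1 - γ 0 1 * Q with hC
  have hne : ¬ (A = 0 ∧ B = 0 ∧ C = 0) := by
    rintro ⟨h₁, h₂, h₃⟩
    apply hQ1
    refine eq_one_of_moebius_coeffs_zero (NeZero.ne Q) hM0 hbez hdet (a := γ 0 0) (b := γ 0 1) (c := γ 1 0) (d := γ 1 1) ?_ ?_ ?_
    · have : (N : ℤ) = Q * M := by exact_mod_cast hNQM
      linear_combination h₁ + γ 0 0 * this
    · have : (N : ℤ) = Q * M := by exact_mod_cast hNQM
      linear_combination h₂ + γ 0 1 * this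
    · linear_combination h₃
  -- the quadratic over `ℂ`
  set p : Polynomial ℂ := Polynomial.C (A : ℂ) * Polynomial.X ^ 2 + Polynomial.C (B : ℂ) * Polynomial.X + Polynomial.C (C : ℂ) with hp
  have hp0 : p ≠ 0 := by
    intro h0
    apply hne
    have c2 : p.coeff 2 = A := by
      rw [hp, Polynomial.coeff_add, Polynomial.coeff_add, Polynomial.coeff_C_mul_X_pow, Polynomial.coeff_C_mul_X,
        Polynomial.coeff_C]
      norm_num
    have c1 : p.coeff 1 = B := by
      rw [hp, Polynomial.coeff_add, Polynomial.coeff_add, Polynomial.coeff_C_mul_X_pow, Polynomial.coeff_C_mul_X,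
        Polynomial.coeff_C]
      norm_num
    have c0 : p.coeff 0 = C := by
      rw [hp, Polynomial.coeff_add, Polynomial.coeff_add, Polynomial.coeff_C_mul_X_pow, Polynomial.coeff_C_mul_X,
        Polynomial.coeff_C]
      norm_num
    rw [h0, Polynomial.coeff_zero] at c2 c1 c0
    exact ⟨by exact_mod_cast c2.symm, by exact_mod_cast c1.symm, by exact_mod_cast c0.symm⟩
  have hval := val_glCast_atkinLehnerW N Q hQN hc
  have hdetw : 0 < (glCast (atkinLehnerW N Q : GL (Fin 2) ℚ)).det.val := by
    rw [det_glCast_atkinLehnerW]; exact_mod_cast NeZero.pos Q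
  refine ((Polynomial.finite_setOf_isRoot hp0).preimage
    (Set.injOn_of_injective (f := fun z : ℍ ↦ (z : ℂ)) fun a b h ↦ UpperHalfPlane.ext h)).subset ?_
  intro τ hτ
  simp only [Set.mem_setOf_eq] at hτ
  simp only [Set.mem_preimage, Set.mem_setOf_eq, Polynomial.IsRoot.def]
  have hcoe := congrArg (fun z : ℍ ↦ (z : ℂ)) hτ
  rw [coe_smul_of_det_pos hdetw, coe_SL2_smul] at hcoe
  have hd1 : UpperHalfPlane.denom (glCast (atkinLehnerW N Q : GL (Fin 2) ℚ)) τ ≠ 0 := UpperHalfPlane.denom_ne_zero _ τ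
  have hd2 : (γ 1 0 : ℂ) * τ + γ 1 1 ≠ 0 := SL2_denom_ne_zero γ τ
  rw [div_eq_div_iff hd1 hd2] at hcoe
  simp only [UpperHalfPlane.num, UpperHalfPlane.denom, hval, Matrix.of_apply, Matrix.cons_val', Matrix.cons_val_zero,
    Matrix.cons_val_one, Matrix.cons_val_fin_one] at hcoe
  push_cast at hcoe
  rw [hp, hA, hB, hC]
  simp only [Polynomial.eval_add, Polynomial.eval_mul, Polynomial.eval_C, Polynomial.eval_pow, Polynomial.eval_X]
  push_cast
  linear_combination hcoe

/-! ## §3 Countability of the fixed loci on `Y₀(N)` -/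

/-- **The fixed locus of `w(Q)` on `Y₀(N)` (pulled back to `ℍ`) is countable** for `Q ∥ N`, `Q ≠ 1`. [folklore] -/
theorem countable_setOf_y0mk_atkinLehnerW_smul_eq {Q : ℕ} [NeZero Q] (hQN : Q ∣ N) (hc : Nat.Coprime Q (N / Q)) (hQ1 : Q ≠ 1) :
    {τ : ℍ | Y0.mk N (glCast (atkinLehnerW N Q : GL (Fin 2) ℚ) • τ) = Y0.mk N τ}.Countable := by
  have hset : {τ : ℍ | Y0.mk N (glCast (atkinLehnerW N Q : GL (Fin 2) ℚ) • τ) = Y0.mk N τ} =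
      ⋃ γ : Gamma0 N, {τ : ℍ | glCast (atkinLehnerW N Q : GL (Fin 2) ℚ) • τ = (γ : SL(2, ℤ)) • τ} := by
    ext τ
    simp only [Set.mem_setOf_eq, Set.mem_iUnion, Y0.mk_eq_mk_iff]
    constructor
    · rintro ⟨γ, h⟩
      exact ⟨γ, h.symm⟩
    · rintro ⟨γ, h⟩
      exact ⟨γ, h.symm⟩
  rw [hset]
  haveI : Countable SL(2, ℤ) := countable_SL2Z
  haveI : Countable (Gamma0 N) := Subtype.countable
  exact Set.countable_iUnion fun γ ↦ (finite_setOf_atkinLehnerW_smul_eq_smul hQN hc hQ1 (γ : SL(2, ℤ))).countable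

/-- `Q_S ≠ 1` for a non-empty set `S` of primes of `N`. [folklore] -/
theorem prodOrdProj_ne_one {S : Finset ℕ} (hS : S ⊆ N.primeFactors) (hne : S.Nonempty) : (∏ p ∈ S, p ^ N.factorization p) ≠ 1 := by
  obtain ⟨p, hp⟩ := hne
  have hpr := Nat.prime_of_mem_primeFactors (hS hp)
  have hlt : 1 < p ^ N.factorization p :=
    Nat.one_lt_pow (Nat.pos_iff_ne_zero.mp (Nat.Prime.factorization_pos_of_dvd hpr (NeZero.ne N) (Nat.dvd_of_mem_primeFactors (hS hp)))) hpr.one_lt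
  intro h1
  have hdvd : p ^ N.factorization p ∣ ∏ q ∈ S, q ^ N.factorization q := Finset.dvd_prod_of_mem _ hp
  rw [h1] at hdvd
  exact absurd (Nat.le_of_dvd one_pos hdvd) (not_le.mpr hlt)

/-- **The bad locus is countable**: the set of `τ ∈ ℍ` whose `Y₀(N)`-class is fixed by some `w(Q_S)`, `∅ ≠ S ⊆` primes of `N`. [folklore] -/
theorem countable_setOf_exists_y0mk_atkinLehnerW_prodOrdProj_smul_eq :
    {τ : ℍ | ∃ (S : Finset ℕ) (hS : S ⊆ N.primeFactors), S.Nonempty ∧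
      haveI : NeZero (∏ p ∈ S, p ^ N.factorization p) := ⟨(prodOrdProj_pos S hS).ne'⟩
      Y0.mk N (glCast (atkinLehnerW N (∏ p ∈ S, p ^ N.factorization p) : GL (Fin 2) ℚ) • τ) = Y0.mk N τ}.Countable := by
  have hsub : {τ : ℍ | ∃ (S : Finset ℕ) (hS : S ⊆ N.primeFactors), S.Nonempty ∧
      haveI : NeZero (∏ p ∈ S, p ^ N.factorization p) := ⟨(prodOrdProj_pos S hS).ne'⟩
      Y0.mk N (glCast (atkinLehnerW N (∏ p ∈ S, p ^ N.factorization p) : GL (Fin 2) ℚ) • τ) = Y0.mk N τ} ⊆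
      ⋃ S ∈ N.primeFactors.powerset, {τ : ℍ | ∃ (hS : S ⊆ N.primeFactors), S.Nonempty ∧
        haveI : NeZero (∏ p ∈ S, p ^ N.factorization p) := ⟨(prodOrdProj_pos S hS).ne'⟩
        Y0.mk N (glCast (atkinLehnerW N (∏ p ∈ S, p ^ N.factorization p) : GL (Fin 2) ℚ) • τ) = Y0.mk N τ} := by
    intro τ hτ
    obtain ⟨S, hS, hne, h⟩ := hτ
    exact Set.mem_biUnion (Finset.mem_powerset.mpr hS) ⟨hS, hne, h⟩
  refine Set.Countable.mono hsub (Set.Countable.biUnion (Finset.countable_toSet _) fun S hSmem ↦ ?_)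
  have hS : S ⊆ N.primeFactors := Finset.mem_powerset.mp hSmem
  by_cases hne : S.Nonempty
  · haveI : NeZero (∏ p ∈ S, p ^ N.factorization p) := ⟨(prodOrdProj_pos S hS).ne'⟩
    refine (countable_setOf_y0mk_atkinLehnerW_smul_eq (prodOrdProj_dvd S hS) (coprime_prodOrdProj S hS)
      (prodOrdProj_ne_one hS hne)).mono ?_
    intro τ hτ
    obtain ⟨_, _, h⟩ := hτ
    exact h
  · refine (Set.countable_empty : (∅ : Set ℍ).Countable).mono ?_
    intro τ hτ
    obtain ⟨_, hne', _⟩ := hτ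
    exact (hne hne').elim

/-! ## §4 `E(ℂ)` is uncountable: generic points exist -/

/-- **`E(ℂ)` is uncountable**: `uniformize : ℂ → E(ℂ)` is onto with countable fibres `z₀ + Λ`. [folklore] -/
theorem not_countable_univ_point {W : WeierstrassCurve ℚ} (D : ModularParametrizationData W N) :
    ¬ (Set.univ : Set (W.baseChange ℂ).toAffine.Point).Countable := by
  intro h
  have hfib : ∀ P : (W.baseChange ℂ).toAffine.Point, (D.uniformize ⁻¹' {P}).Countable := by
    intro P
    obtain ⟨z₀, hz₀⟩ := D.uniformize_surjective P
    have hsub : D.uniformize ⁻¹' {P} ⊆ Set.range (fun mn : ℤ × ℤ ↦ z₀ + (mn.1 * D.L.ω₁ + mn.2 * D.L.ω₂)) := by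
      intro z hz
      have hz' : D.uniformize (z - z₀) = 0 := by
        rw [map_sub, Set.mem_preimage.mp hz, hz₀, sub_self]
      rw [D.uniformize_eq_zero_iff] at hz'
      obtain ⟨m, n, hmn⟩ := PeriodPair.mem_lattice.mp hz'
      exact ⟨(m, n), by simp only; rw [hmn]; ring⟩
    exact (Set.countable_range _).mono hsub
  have huniv : (Set.univ : Set ℂ) = ⋃ P ∈ (Set.univ : Set (W.baseChange ℂ).toAffine.Point), D.uniformize ⁻¹' {P} := by
    ext z
    simp
  have hC : (Set.univ : Set ℂ).Countable := by
    rw [huniv]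
    exact h.biUnion fun P _ ↦ hfib P
  have hR : (Set.univ : Set ℝ).Countable := by
    have : (Set.univ : Set ℝ) = Complex.re '' Set.univ := (Set.image_univ_of_surjective Complex.re_surjective).symm
    rw [this]
    exact hC.image _
  exact Cardinal.not_countable_real hR

/-- A countable set of points of `E(ℂ)` misses some point. [folklore] -/
theorem exists_point_not_mem_of_countable {W : WeierstrassCurve ℚ} (D : ModularParametrizationData W N)
    {B : Set (W.baseChange ℂ).toAffine.Point} (hB : B.Countable) : ∃ P, P ∉ B := by
  by_contra h
  push Not at h
  exact not_countable_univ_point D (hB.mono fun P _ ↦ h P)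

end Summit.BirchSwinnertonDyer.BirchSwinnertonDyer.Theorems.ManinLocalTwoThree.AtkinLehnerOrbit

end
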